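import Summits.ResolutionOfSingularities.ResolutionOfSingularities.Theorems.HilbertSamuelEliminationSigmaMaxModificationsCorridor3WLadderIsoTailsFormalFrameAssemblyStepIdeal
import HarnessLib

/-!
# [OURS · L1 W4.2] D14 / K2-sep ROUTE A, brick (γ) part 1: **THE FRAME LINK FOR FINITE-POINT CENTRES** — res-type-071's G2a-FL
# `FormalFrameGen.exists_frameStep_ideal` (p542215) with the hypothesis `T.C n = {x_n}` (+ closedness) replaced by the STALK form
# `𝓘(C_n)_{x_n} = 𝔪_{x_n}` (crux `SigmaMaxModifications` stmt-ResolutionOfSingularities-18506 / conjunct stmt-…-19249; line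
# `w_ladder_rows` v8.5, registered stub `stub_isoSepRecurrent`; res-L1-w42-plan-1 WORD 2026-08-27T16:25:47Z; design
# `L/res-L1-w42-stub-2/k2sep/K2SEP-DESIGN.md` §2)

Prover res-L1-w42-stub-2 (gen 5). Helper file `--supports stmt-ResolutionOfSingularities-19249 --as helper`; kernel only, no definitions, no
named fact. OURS (cell res-hironaka, slot W4.2); NOT statements of [Hironaka2017] nor of [CossartJannsenSaito2020] / [CossartPiltant2009].
AI-written — the PROOF IS res-type-071's, adapted in exactly two places (the socket `EmbeddedStep.exists_maximalIdeal_presentation_ideal_of_eq`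
instead of `…_tower`, and `hD` instead of `stalkIdeal_centreIdeal_eq_maximalIdeal`); AI review is weaker than expert review.

WHY: after a ground-field base change `X_n ×_k K` of an isolated point tower the centres become FINITE SETS of closed points
(Spec(κ(x_n) ⊗_k K)); the K1 chain reads the centre only through its stalk at the marked point, which is still the maximal ideal.

[OURS · L1 W4.2; AI-written] [cite: CossartPiltant2008, proof of Lemma 4.3 (3)] [cite: CossartPiltant2009, ch. 3 I.9]
-/

set_option linter.dupNamespace false

noncomputable section

open MvPowerSeries IsLocalRing AlgebraicGeometry CategoryTheory
open Literature.AlgebraicGeometry.Resolution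
open Literature.AlgebraicGeometry.CossartJannsenSaito2020
open Summit.ResolutionOfSingularities.ResolutionOfSingularities.Cruxes.SigmaMaxModifications.IdeasL1C5

namespace Summit.ResolutionOfSingularities.ResolutionOfSingularities.Cruxes.SigmaMaxModifications.IdeasL1C5

universe u

namespace FormalFrameGen

section Step

variable {d : ℕ} {κ : Type u} [Field κ]

set_option maxHeartbeats 1600000 in
-- long existential packaging over the affine blowup algebra of a stalk (as in res-type-071's socket files and p529646)
/-- **G2a-FL FOR FINITE-POINT CENTRES (the frame link with `hC : T.C n = {x_n}` replaced by `hD : 𝓘(C_n)_{x_n} = 𝔪_{x_n}`).** Verbatim res-type-071's `exists_frameStep_ideal` (p542215) with the point-centre hypothesis weakened to «the centre is the reduced point `x_n` NEAR `x_n`» — true for any centre that is a finite set of closed points containing `x_n` (the shape produced by a ground-field base change of a point tower: res-L1-w42-stub-2 `K2SEP-DESIGN.md` §2). ORIGINAL DOCSTRING (071): Stage `n` of a point tower (`T.C n = {x_n}`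
closed, `π_n(x_{n+1}) = x_n`) carries: a presentation `σ : R ↠ 𝒪_{X_n,x_n}` with `R` regular local of embedding dimension `d + 1`
and regular system of parameters `x = (t, y_1, …, y_d)` (`t = x 0`), ARBITRARY kernel; the hypothesis (FREE) «`x_{n+1}` lies in the
`t`-chart» (`π♯σ(t) ∣ π♯σ(x_k)`); and a FORMAL FRAME `ψ : R → κ⟦X_0, …, X_d⟧` — a local homomorphism with `ψ t = X 0`,
`ψ (x i) ≡ X i + λ_i X 0 (mod 𝔪²)` and surjective residue map. If the step is RATIONAL and NOT a SATELLITE step, then stage `n+1`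
carries THE SAME DATA: `R′ = R[𝔪/t]_𝔑` (`exists_maximalIdeal_presentation_ideal_tower`; `𝔑 = stepPrime c₁` by point matching), the
new regular system `x′ = (t, x_k/t − ã_k)`, `σ′ : R′ ↠ 𝒪_{X_{n+1},x_{n+1}}` with the IDEAL STRICT TRANSFORM links
`(ker σ)·R′ ⊆ ker σ′ = sat_t((ker σ)·R′)`, `σ′ ∘ ι = π_n♯ ∘ σ`, `ι t = t′`, (FREE) at stage `n+1`
(`not_isSatelliteStep_iff_forall_dvd_of_eq`), and the propagated frame `ψ′ = stepFrame c₁` with its slopes, residue surjectivity and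
the commutation `ψ′ ∘ ι = (y ↦ t y + c₁ t) ∘ ψ`. [OURS · L1 W4.2]
[cite: CossartPiltant2008, proof of Lemma 4.3 (3)] [cite: CossartPiltant2009, ch. 3 I.9] -/
theorem exists_frameStep_ideal_of_stalkIdeal_eq (T : BlowupTower.{u}) (pt : ∀ n, T.X n) (n : ℕ)
    (hD : stalkIdeal (T.centreIdeal n) (pt n) = maximalIdeal ((T.X n).presheaf.stalk (pt n)))
    (hpt : (T.π n) (pt (n + 1)) = pt n)
    (hpt' : (T.π (n + 1)) (pt (n + 2)) = pt (n + 1))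
    (hrat : IsRationalStep T pt n) (hnsat : ¬ IsSatelliteStep T pt n)
    {R : Type u} [CommRing R] [IsRegularLocalRing R] (hd : (maximalIdeal R).spanFinrank = d + 1)
    (x : Fin (d + 1) → R) (hx : Ideal.span (Set.range x) = maximalIdeal R)
    (σ : R →+* (T.X n).presheaf.stalk (pt n)) (hσ : Function.Surjective σ)
    (hfree : ∀ k, ((T.π n).stalkMap (pt (n + 1))).hom (((T.X n).presheaf.stalkCongr (.of_eq hpt)).inv (σ (x 0))) ∣
      ((T.π n).stalkMap (pt (n + 1))).hom (((T.X n).presheaf.stalkCongr (.of_eq hpt)).inv (σ (x k))))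
    (ψ : R →+* MvPowerSeries (Fin (d + 1)) κ) [IsLocalHom ψ] (hψt : ψ (x 0) = X 0) (lam : Fin (d + 1) → κ)
    (hlam : ∀ i, i ≠ 0 → ψ (x i) - X i - C (lam i) * X 0 ∈ maximalIdeal (MvPowerSeries (Fin (d + 1)) κ) ^ 2)
    (hres : ∀ a : κ, ∃ r : R, ψ r - C a ∈ maximalIdeal (MvPowerSeries (Fin (d + 1)) κ)) :
    ∃ (R' : Type u) (_ : CommRing R') (_ : IsRegularLocalRing R') (x' : Fin (d + 1) → R')
      (σ' : R' →+* (T.X (n + 1)).presheaf.stalk (pt (n + 1))) (ψ' : R' →+* MvPowerSeries (Fin (d + 1)) κ)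
      (lam' : Fin (d + 1) → κ) (ι : R →+* R') (c₁ : Fin (d + 1) → κ),
      (maximalIdeal R').spanFinrank = d + 1 ∧ Ideal.span (Set.range x') = maximalIdeal R' ∧
      Function.Surjective σ' ∧
      (RingHom.ker σ).map ι ≤ RingHom.ker σ' ∧
      (∀ g, x' 0 * g ∈ RingHom.ker σ' → g ∈ RingHom.ker σ') ∧
      (∀ g, g ∈ RingHom.ker σ' → ∃ N : ℕ, x' 0 ^ N * g ∈ (RingHom.ker σ).map ι) ∧
      (∀ r, σ' (ι r) = ((T.π n).stalkMap (pt (n + 1))).hom (((T.X n).presheaf.stalkCongr (.of_eq hpt)).inv (σ r))) ∧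
      ι (x 0) = x' 0 ∧
      (∀ k, ((T.π (n + 1)).stalkMap (pt (n + 2))).hom
          (((T.X (n + 1)).presheaf.stalkCongr (.of_eq hpt')).inv (σ' (x' 0))) ∣
        ((T.π (n + 1)).stalkMap (pt (n + 2))).hom
          (((T.X (n + 1)).presheaf.stalkCongr (.of_eq hpt')).inv (σ' (x' k)))) ∧
      IsLocalHom ψ' ∧ ψ' (x' 0) = X 0 ∧
      (∀ i, i ≠ 0 → ψ' (x' i) - X i - C (lam' i) * X 0 ∈ maximalIdeal (MvPowerSeries (Fin (d + 1)) κ) ^ 2) ∧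
      (∀ a : κ, ∃ r : R', ψ' r - C a ∈ maximalIdeal (MvPowerSeries (Fin (d + 1)) κ)) ∧
      (∀ r, ψ' (ι r) = subst (SeriesGen.transChartSubst c₁) (ψ r)) := by
  classical
  obtain ⟨a, 𝔑, h𝔑max, σ', h1, h2, h3, h4, h5, h6, h7, h8, h9, h10, h11, h12, h13, h14, h15⟩ :=
    EmbeddedStep.exists_maximalIdeal_presentation_ideal_of_eq x 0 (T.isBlowup n) (pt (n + 1)) (pt n) hpt hD hd hx σ hσ hfree hrat
  have hxm : ∀ k, x k ∈ maximalIdeal R := fun k => hx.le (Ideal.subset_span ⟨k, rfl⟩)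
  -- the lifts `ã` (with `ã_0 := 1`, as `t/t = 1`) and the matching constants `c₁` (kept opaque: only their equations are used)
  obtain ⟨A, hA0, hA⟩ : ∃ A : Fin (d + 1) → R, A 0 = 1 ∧ ∀ k (hk : k ≠ 0), A k = a ⟨k, hk⟩ :=
    ⟨fun k => if hk : k = 0 then 1 else a ⟨k, hk⟩, dif_pos rfl, fun k hk => dif_neg hk⟩
  obtain ⟨c₁, hc₁⟩ : ∃ c₁ : Fin (d + 1) → κ, ∀ k, c₁ k + lam k = constantCoeff (ψ (A k)) :=
    ⟨fun k => constantCoeff (ψ (A k)) - lam k, fun k => sub_add_cancel _ _⟩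
  -- §1: the tower's point `𝔑` IS the point `stepPrime c₁` seen by the frame
  have hgen𝔑 : ∀ k, blowupAlgebra.gen (maximalIdeal R) (x 0) (x k) (hxm k) - algebraMap R _ (A k) ∈ 𝔑 := by
    intro k
    by_cases hk : k = 0
    · subst hk
      rw [hA0, map_one, blowupAlgebra.gen_self, sub_self]
      exact 𝔑.zero_mem
    · rw [hA k hk]; exact h4 k hk
  have hgenS : ∀ k, blowupAlgebra.gen (maximalIdeal R) (x 0) (x k) (hxm k) - algebraMap R _ (A k) ∈
      stepPrime c₁ hψt := by
    intro k
    by_cases hk : k = 0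
    · subst hk
      rw [hA0, map_one, blowupAlgebra.gen_self, sub_self]
      exact Ideal.zero_mem _
    · have hct : ψ (A k) - C (c₁ k + lam k) ∈ maximalIdeal (MvPowerSeries (Fin (d + 1)) κ) := by
        rw [hc₁ k]; exact sub_C_constantCoeff_mem _
      exact newCoord_mem_stepPrime c₁ hψt (hxm k) hk (hlam k hk) hct
  have hRR : 𝔑.comap (algebraMap R _) ≤ (stepPrime c₁ hψt).comap (algebraMap R _) := by
    rw [h2]
    intro r hr
    rw [Ideal.mem_comap, Ideal.mem_comap, stepLift_algebraMap]
    exact span_X_zero_le_maximalIdeal (substHom_mem_span_X_zero c₁ (map_nonunit ψ r hr))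
  have h𝔑eq : 𝔑 = stepPrime c₁ hψt :=
    eq_stepPrime_of_isMaximal_of_le c₁ hψt h𝔑max
      (FormalFrame.le_of_forall_gen_sub_mem x 0 hx hxm A hgen𝔑 hgenS hRR)
  -- so `R′ := R[𝔪/t]_𝔑` is a localisation at `stepPrime c₁` and carries the frame `stepFrame c₁`
  have hM : (stepPrime c₁ hψt).primeCompl = 𝔑.primeCompl :=
    Submonoid.ext fun y => by
      show y ∉ stepPrime c₁ hψt ↔ y ∉ 𝔑
      rw [h𝔑eq]
  haveI : IsLocalization.AtPrime (Localization.AtPrime 𝔑) (stepPrime c₁ hψt) := by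
    show IsLocalization (stepPrime c₁ hψt).primeCompl (Localization.AtPrime 𝔑)
    rw [hM]
    exact Localization.isLocalization
  haveI : IsRegularLocalRing (Localization.AtPrime 𝔑) := h5
  -- the new frame, transition, coordinates
  set ψ' : Localization.AtPrime 𝔑 →+* MvPowerSeries (Fin (d + 1)) κ := stepFrame c₁ hψt (Localization.AtPrime 𝔑)
    with hψ'def
  set ι : R →+* Localization.AtPrime 𝔑 :=
    (algebraMap (blowupAlgebra (maximalIdeal R) (x 0)) (Localization.AtPrime 𝔑)).comp
      (algebraMap R (blowupAlgebra (maximalIdeal R) (x 0))) with hιdef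
  obtain ⟨x', hx'def⟩ : ∃ x' : Fin (d + 1) → Localization.AtPrime 𝔑, x' = fun k =>
      if hk : k = 0 then algebraMap _ (Localization.AtPrime 𝔑)
        (algebraMap R (blowupAlgebra (maximalIdeal R) (x 0)) (x 0))
      else algebraMap _ (Localization.AtPrime 𝔑)
        (blowupAlgebra.gen (maximalIdeal R) (x 0) (x k) (hx.le (Ideal.subset_span ⟨k, rfl⟩)) -
          algebraMap R _ (a ⟨k, hk⟩)) := ⟨_, rfl⟩
  have hx'0 : x' 0 = algebraMap _ (Localization.AtPrime 𝔑)
      (algebraMap R (blowupAlgebra (maximalIdeal R) (x 0)) (x 0)) := by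
    rw [hx'def]; exact dif_pos rfl
  have hx'k : ∀ k (hk : k ≠ 0), x' k = algebraMap _ (Localization.AtPrime 𝔑)
      (blowupAlgebra.gen (maximalIdeal R) (x 0) (x k) (hxm k) - algebraMap R _ (a ⟨k, hk⟩)) := fun k hk => by
    rw [hx'def]; exact dif_neg hk
  -- `ψ′` on `R`: the commutation with the translated chart substitution
  have hψ'ι : ∀ r, ψ' (ι r) = substHom c₁ (ψ r) := fun r => by
    rw [hψ'def, hιdef, RingHom.comp_apply, stepFrame_algebraMap, stepLift_algebraMap]
  -- (FREE) at stage `n + 1` from `¬ IsSatelliteStep T pt n`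
  have hD' : stalkIdeal (T.centreIdeal n) ((T.π n) (pt (n + 1))) =
      maximalIdeal ((T.X n).presheaf.stalk ((T.π n) (pt (n + 1)))) := by
    rw [hpt]; exact hD
  have hE := EmbeddedStep.map_maximalIdeal_stalkMap_eq_of_stalkIdeal (T.π n) (T.centreIdeal n) (pt (n + 1)) hD' h14
  have hc' : Ideal.span (Set.range fun k => σ' (x' k)) = maximalIdeal ((T.X (n + 1)).presheaf.stalk (pt (n + 1))) := by
    have hr : (Set.range fun k => σ' (x' k)) = σ' '' Set.range x' := by
      rw [← Set.range_comp]; rfl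
    rw [hr, ← Ideal.map_span, hx'def, h7]
    exact IsLocalRing.map_maximalIdeal_of_surjective (R := Localization.AtPrime 𝔑)
      (S := (T.X (n + 1)).presheaf.stalk (pt (n + 1))) σ' h8
  have hg : σ' (x' 0) =
      ((T.π n).stalkMap (pt (n + 1))).hom (((T.X n).presheaf.stalkCongr (.of_eq hpt)).inv (σ (x 0))) := by
    rw [hx'0]; exact h12 (x 0)
  have hfree' := (EmbeddedStep.not_isSatelliteStep_iff_forall_dvd_of_eq T pt n hpt' hE hc').mp hnsat
  -- the new slopes
  have hz : ∀ i (hi : i ≠ 0), ψ' (x' i) - X i ∈ Ideal.span {(X 0 : MvPowerSeries (Fin (d + 1)) κ)} := by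
    intro i hi
    have hct : ψ (a ⟨i, hi⟩) - C (c₁ i + lam i) ∈ maximalIdeal (MvPowerSeries (Fin (d + 1)) κ) := by
      rw [hc₁ i, hA i hi]; exact sub_C_constantCoeff_mem _
    have := stepLift_newCoord_sub_mem_span c₁ hψt (hxm i) hi (hlam i hi) hct
    rw [hx'k i hi, hψ'def, stepFrame_algebraMap]
    exact this
  have hl : ∀ i (hi : i ≠ 0), ∃ lam' : κ,
      ψ' (x' i) - X i - C lam' * X 0 ∈ maximalIdeal (MvPowerSeries (Fin (d + 1)) κ) ^ 2 :=
    fun i hi => exists_sub_C_mul_X_zero_mem_sq (hz i hi)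
  choose lamf hlamf using hl
  obtain ⟨lam', hlam'⟩ : ∃ lam' : Fin (d + 1) → κ, ∀ i (hi : i ≠ 0), lam' i = lamf i hi :=
    ⟨fun i => if hi : i = 0 then 0 else lamf i hi, fun i hi => dif_neg hi⟩
  -- the transition on `R` is the structure map through the blowup algebra
  have hιr : ∀ r, ι r = algebraMap _ (Localization.AtPrime 𝔑) (algebraMap R (blowupAlgebra (maximalIdeal R) (x 0)) r) :=
    fun r => by rw [hιdef, RingHom.comp_apply]
  have hιmap : (RingHom.ker σ).map ι =
      ((RingHom.ker σ).map (algebraMap R (blowupAlgebra (maximalIdeal R) (x 0)))).map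
        (algebraMap _ (Localization.AtPrime 𝔑)) := by
    rw [hιdef, Ideal.map_map]
  -- assemble
  refine ⟨Localization.AtPrime 𝔑, inferInstance, h5, x', σ', ψ', lam', ι, c₁, h6, ?_, h8, ?_, ?_, ?_, ?_, ?_, ?_, ?_, ?_,
    ?_, ?_, ?_⟩
  · -- the new regular system of parameters
    rw [hx'def]; exact h7
  · -- `(ker σ)·R′ ⊆ ker σ′`
    rw [hιmap]; exact h9
  · -- `(ker σ′ : t) = ker σ′`
    intro g hg'
    rw [hx'0] at hg'
    exact h10 g hg'
  · -- `ker σ′ ⊆ sat_t((ker σ)·R′)`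
    intro g hg'
    obtain ⟨N, hN⟩ := h11 g hg'
    refine ⟨N, ?_⟩
    rw [hx'0, hιmap]
    exact hN
  · -- `σ′ ∘ ι = π♯ ∘ σ`
    intro r
    rw [hιr]; exact h12 r
  · -- `ι t = t′`
    rw [hιr, hx'0]
  · -- (FREE) at stage `n + 1`
    intro k
    rw [hg]
    exact hfree' k
  · -- `ψ′` is local
    rw [hψ'def]; exact isLocalHom_stepFrame c₁ hψt _
  · -- `ψ′ (t) = t`
    rw [hx'0, hψ'def, stepFrame_algebraMap, stepLift_t]
  · -- slopes
    intro i hi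
    rw [hlam' i hi]
    exact hlamf i hi
  · -- residue surjectivity
    intro a₀
    obtain ⟨r, hr⟩ := hres a₀
    refine ⟨ι r, ?_⟩
    rw [hψ'ι]
    exact span_X_zero_le_maximalIdeal (substHom_sub_C_mem_span c₁ hr)
  · -- the commutation
    intro r
    rw [hψ'ι, substHom_apply]

end Step

end FormalFrameGen

end Summit.ResolutionOfSingularities.ResolutionOfSingularities.Cruxes.SigmaMaxModifications.IdeasL1C5

end
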